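import Summits.CriticalPhenomena.PercolationContinuityZ3.Theorems.PercNearOneGluingNoHeavyLowerTailAntitheticCycleOplusExt
import Summits.CriticalPhenomena.PercolationContinuityZ3.Theorems.PercNearOneGluingNoHeavyLowerTailAntitheticCycleTIIExt
import Summits.CriticalPhenomena.PercolationContinuityZ3.Theorems.PercNearOneGluingNoHeavyLowerTailAntitheticHandlePrinciple
import Summits.CriticalPhenomena.PercolationContinuityZ3.Theorems.PercNearOneGluingNoHeavyLowerTailAntitheticHandle
import HarnessLib

/-!
# `NoHeavyLowerTail` (stmt-CriticalPhenomena-4575) — antithetic cluster pairs: THEOREM Θ WITH PENDANT TREES (HOME/THEOREM-Theta.md §3 in full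
# generality: cycle through s with a pendant forest, plus one handle through x; prim-hp-2 gen 62)

Support file (`--supports stmt-CriticalPhenomena-4575`, hull-port prover `prim-hp-2`, gen 62).  No definitions, no named facts, no sorries;
standard axioms.  VERTEX version.

A PENDANT FOREST on an edge set `E` is given as a LEAF SEQUENCE `att k – ℓ k` (`k < m`): each `ℓ k` is a fresh vertex (meeting only loops of
`E ∪ {att i ℓ i : i < k}`), `att k ≠ ℓ k`, `s ≠ ℓ k`; successive leaves may hang on earlier leaves, so every pendant forest (trees at any
vertices, including `s`) arises.  `Antithetic.Box.mem_leaves_iff` / `Antithetic.Box.dom_leaves`: the events `{u ∈ X}` (`u` not a leaf) and red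
domination are unchanged along a leaf sequence (iterating `Box.mem_insert_leaf_iff` / `Box.dom_insert_leaf`).
**`Antithetic.Cyc.forest_handle_vertex_sum_nonneg` (THEOREM Θ with pendant trees)**: cycle `v 0 = s, …, v (n−1)` with a pendant forest,
`P = v p`, `Q = v q` (`0 < p, q < n`), arms `u 0 = P … u a = y`, `w 0 = Q … w b = z` of fresh vertices, `x` fresh joined to `y, z`, `yz ∉ H`:
the vertex antithetic inequality at `R = {x}` holds — by the HANDLE PRINCIPLE (`Pendant.handle_vertex_sum_nonneg_of`) fed with THEOREM
⊕-CYCLE and PR4 in extension form (`Cyc.oplus_cycle_ext`, `Cyc.termTwo_cycle_ext`, no forced pairs).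
[cite: VandenbergHaggstromKahn2005, §1 p. 6 ("Harris' inequality"), §1 p. 3 (open cluster `C_s`)]
-/

noncomputable section

namespace Summit.CriticalPhenomena.PercolationContinuityZ3.Theorems

open Literature.Probability.Percolation
open scoped Classical

namespace Antithetic

namespace Box

variable {V : Type*} {E : Set (Sym2 V)} {s : V} {att ℓ : ℕ → V} {m : ℕ}
  (hleaf : ∀ k, k < m → ∀ f ∈ E ∪ {e | ∃ i, i < k ∧ e = s(att i, ℓ i)}, ℓ k ∈ f → f.IsDiag)
  (hne : ∀ k, k < m → att k ≠ ℓ k) (hsℓ : ∀ k, k < m → s ≠ ℓ k)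

/-- The leaf sequence grows by one pair. -/
theorem union_leaves_succ (E : Set (Sym2 V)) (att ℓ : ℕ → V) (k : ℕ) :
    E ∪ {e | ∃ i, i < k + 1 ∧ e = s(att i, ℓ i)} = insert s(att k, ℓ k) (E ∪ {e | ∃ i, i < k ∧ e = s(att i, ℓ i)}) := by
  ext e
  simp only [Set.mem_union, Set.mem_setOf_eq, Set.mem_insert_iff]
  constructor
  · rintro (h | ⟨i, hi, rfl⟩)
    · exact Or.inr (Or.inl h)
    · by_cases hik : i = k
      · subst hik; exact Or.inl rfl
      · exact Or.inr (Or.inr ⟨i, by omega, rfl⟩)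
  · rintro (rfl | h | ⟨i, hi, rfl⟩)
    · exact Or.inr ⟨k, Nat.lt_succ_self k, rfl⟩
    · exact Or.inl h
    · exact Or.inr ⟨i, Nat.lt_succ_of_lt hi, rfl⟩

/-- The empty leaf sequence. -/
theorem union_leaves_zero (E : Set (Sym2 V)) (att ℓ : ℕ → V) : E ∪ {e | ∃ i, i < 0 ∧ e = s(att i, ℓ i)} = E := by
  ext e
  simp only [Set.mem_union, Set.mem_setOf_eq]
  constructor
  · rintro (h | ⟨i, hi, -⟩)
    · exact h
    · omega
  · exact fun h => Or.inl h

include hleaf hne hsℓ in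
/-- **The event survives a pendant forest**: for `u` not a leaf and `k ≤ m`, `u ∈ X_{E ∪ leaves_k} T ↔ u ∈ X_E T`. [this work] -/
theorem mem_leaves_iff {k : ℕ} (hk : k ≤ m) (T : Set (Sym2 V)) {u : V} (hu : ∀ i, i < m → u ≠ ℓ i) :
    u ∈ openCluster (T ∩ (E ∪ {e | ∃ i, i < k ∧ e = s(att i, ℓ i)})) s ↔ u ∈ openCluster (T ∩ E) s := by
  induction k with
  | zero => rw [union_leaves_zero]
  | succ k ih =>
    rw [union_leaves_succ, mem_insert_leaf_iff (hleaf k (Nat.lt_of_succ_le hk)) (hne k (Nat.lt_of_succ_le hk))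
      (hsℓ k (Nat.lt_of_succ_le hk)) (hu k (Nat.lt_of_succ_le hk))]
    exact ih (Nat.le_of_succ_le hk)

include hleaf hne hsℓ in
/-- **Red domination survives a pendant forest**: if `T, T'` are opposite on the leaf pairs and `Y_E T' ⊆ X_E T` then
`Y_{E ∪ leaves_k} T' ⊆ X_{E ∪ leaves_k} T` (`k ≤ m`). [this work] -/
theorem dom_leaves {k : ℕ} (hk : k ≤ m) {T T' : Set (Sym2 V)}
    (hflip : ∀ i, i < k → (s(att i, ℓ i) ∈ T' ↔ s(att i, ℓ i) ∉ T))
    (hdom : openCluster (T'ᶜ ∩ E) s ⊆ openCluster (T ∩ E) s) :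
    openCluster (T'ᶜ ∩ (E ∪ {e | ∃ i, i < k ∧ e = s(att i, ℓ i)})) s ⊆
      openCluster (T ∩ (E ∪ {e | ∃ i, i < k ∧ e = s(att i, ℓ i)})) s := by
  induction k with
  | zero => rw [union_leaves_zero]; exact hdom
  | succ k ih =>
    rw [union_leaves_succ]
    exact dom_insert_leaf (hleaf k (Nat.lt_of_succ_le hk)) (hne k (Nat.lt_of_succ_le hk)) (hsℓ k (Nat.lt_of_succ_le hk))
      (hflip k (Nat.lt_succ_self k)) (ih (Nat.le_of_succ_le hk) fun i hi => hflip i (Nat.lt_succ_of_lt hi))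

include hleaf hne in
/-- A leaf pair is not a loop and is not a pair of `E`. -/
theorem leaf_pair_not_mem {k : ℕ} (hk : k < m) : s(att k, ℓ k) ∉ E := by
  intro h
  have hd := hleaf k hk _ (Or.inl h) (Sym2.mem_mk_right _ _)
  rw [Sym2.mk_isDiag_iff] at hd
  exact hne k hk hd

end Box

namespace Cyc

variable {V : Type*} [Fintype V] {n : ℕ} {v : ℕ → V} (hn : 3 ≤ n) (hinj : ∀ i j, i < n → j < n → v i = v j → i = j) (hper : v n = v 0)
  {p q : ℕ} (hp0 : 0 < p) (hpn : p < n) (hq0 : 0 < q) (hqn : q < n)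
  -- the pendant forest (leaf sequence on the cycle)
  {att ℓ : ℕ → V} {m : ℕ}
  (hleaf : ∀ k, k < m → ∀ f ∈ edgeSet n v ∪ {e | ∃ i, i < k ∧ e = s(att i, ℓ i)}, ℓ k ∈ f → f.IsDiag)
  (hne : ∀ k, k < m → att k ≠ ℓ k) (hsℓ : ∀ k, k < m → v 0 ≠ ℓ k) (hPℓ : ∀ k, k < m → v p ≠ ℓ k) (hQℓ : ∀ k, k < m → v q ≠ ℓ k)
  -- the arms
  {u w : ℕ → V} {a b : ℕ} (hu0 : u 0 = v p) (hw0 : w 0 = v q)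
  (hufresh : ∀ i, 0 < i → i ≤ a → ∀ f ∈ (edgeSet n v ∪ {e | ∃ i, i < m ∧ e = s(att i, ℓ i)}) ∪ edgeSet b w, u i ∈ f → f.IsDiag)
  (hwfresh : ∀ i, 0 < i → i ≤ b → ∀ f ∈ edgeSet n v ∪ {e | ∃ i, i < m ∧ e = s(att i, ℓ i)}, w i ∈ f → f.IsDiag)
  (huinj : ∀ i j, i ≤ a → j ≤ a → u i = u j → i = j) (hwinj : ∀ i j, i ≤ b → j ≤ b → w i = w j → i = j)
include hn hinj hper hp0 hpn hq0 hqn hleaf hne hsℓ hPℓ hQℓ hu0 hw0 hufresh hwfresh huinj hwinj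

/-- **THEOREM Θ WITH PENDANT TREES** (HOME/THEOREM-Theta.md §3): cycle through `s = v 0` with a pendant forest (leaf sequence `att k – ℓ k`,
`k < m`), cycle vertices `P = v p`, `Q = v q` (`0 < p, q < n`), arms `u 0 = P, …, u a = y` and `w 0 = Q, …, w b = z` of fresh vertices, `x` fresh
joined to `y` and `z`, `yz` not a pair of `H = cycle ∪ forest ∪ arms`; `E = H + xy + xz`.  Then for all monotone `F, G`:
`0 ≤ Σ_{ω : ¬(x ∈ X_E ω ∧ x ∈ Y_E ω)} (F(X_E ω) − F(Y_E ω))·(G(X_E ω) − G(Y_E ω))`. [this work] -/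
theorem forest_handle_vertex_sum_nonneg {x : V}
    (hx : ∀ f ∈ ((edgeSet n v ∪ {e | ∃ i, i < m ∧ e = s(att i, ℓ i)}) ∪ edgeSet b w) ∪ edgeSet a u, x ∈ f → f.IsDiag)
    (hxs : x ≠ v 0) (hxy : x ≠ u a) (hxz : x ≠ w b) (hyz : u a ≠ w b)
    (hg : s(u a, w b) ∉ ((edgeSet n v ∪ {e | ∃ i, i < m ∧ e = s(att i, ℓ i)}) ∪ edgeSet b w) ∪ edgeSet a u)
    {F G : Set V → ℝ} (hF : Monotone F) (hG : Monotone G) :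
    0 ≤ ∑ ω ∈ Finset.univ.filter (fun ω : Set (Sym2 V) =>
        ¬ ((openGraph (ω ∩ insert s(x, u a) (insert s(x, w b)
              (((edgeSet n v ∪ {e | ∃ i, i < m ∧ e = s(att i, ℓ i)}) ∪ edgeSet b w) ∪ edgeSet a u)))).Reachable (v 0) x ∧
          (openGraph (ωᶜ ∩ insert s(x, u a) (insert s(x, w b)
              (((edgeSet n v ∪ {e | ∃ i, i < m ∧ e = s(att i, ℓ i)}) ∪ edgeSet b w) ∪ edgeSet a u)))).Reachable (v 0) x)),
      (F (openCluster (ω ∩ insert s(x, u a) (insert s(x, w b)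
            (((edgeSet n v ∪ {e | ∃ i, i < m ∧ e = s(att i, ℓ i)}) ∪ edgeSet b w) ∪ edgeSet a u))) (v 0)) -
          F (openCluster (ωᶜ ∩ insert s(x, u a) (insert s(x, w b)
            (((edgeSet n v ∪ {e | ∃ i, i < m ∧ e = s(att i, ℓ i)}) ∪ edgeSet b w) ∪ edgeSet a u))) (v 0))) *
        (G (openCluster (ω ∩ insert s(x, u a) (insert s(x, w b)
            (((edgeSet n v ∪ {e | ∃ i, i < m ∧ e = s(att i, ℓ i)}) ∪ edgeSet b w) ∪ edgeSet a u))) (v 0)) -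
          G (openCluster (ωᶜ ∩ insert s(x, u a) (insert s(x, w b)
            (((edgeSet n v ∪ {e | ∃ i, i < m ∧ e = s(att i, ℓ i)}) ∪ edgeSet b w) ∪ edgeSet a u))) (v 0))) := by
  set L : Set (Sym2 V) := {e | ∃ i, i < m ∧ e = s(att i, ℓ i)} with hL
  set E₀ : Set (Sym2 V) := edgeSet n v ∪ L with hE₀
  -- freshness bookkeeping
  have hleafE : ∀ k, k < m → ∀ f ∈ edgeSet n v, ℓ k ∈ f → f.IsDiag := fun k hk f hf => hleaf k hk f (Or.inl hf)
  have hvℓ : ∀ {i : ℕ}, i < n → ∀ k, k < m → v i ≠ ℓ k := by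
    intro i hi k hk h
    have hd := hleafE k hk (edge v i) ⟨i, hi, rfl⟩ (by rw [← h]; exact Sym2.mem_mk_left _ _)
    rw [edge, Sym2.mk_isDiag_iff] at hd
    exact v_ne_succ hn hinj hper hi hd
  have hwfreshC : ∀ i, 0 < i → i ≤ b → ∀ f ∈ edgeSet n v, w i ∈ f → f.IsDiag := fun i hi hib f hf => hwfresh i hi hib f (Or.inl hf)
  have hufreshC : ∀ i, 0 < i → i ≤ a → ∀ f ∈ edgeSet n v, u i ∈ f → f.IsDiag := fun i hi hia f hf => hufresh i hi hia f (Or.inl (Or.inl hf))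
  have hsw : ∀ i, 0 < i → i ≤ b → v 0 ≠ w i := fun i hi hib => v_ne_arm hn hinj hper hwfreshC (by omega) hi hib
  have hPw : ∀ i, 0 < i → i ≤ b → v p ≠ w i := fun i hi hib => v_ne_arm hn hinj hper hwfreshC hpn hi hib
  have hsu : ∀ i, 0 < i → i ≤ a → v 0 ≠ u i := fun i hi hia => v_ne_arm hn hinj hper hufreshC (by omega) hi hia
  have hzu : ∀ i, 0 < i → i ≤ a → w b ≠ u i :=
    fun i hi hia => end_ne_arm hufresh hwinj (fun k hk hka => by rw [hw0]; exact v_ne_arm hn hinj hper hufreshC hqn hk hka) hi hia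
  -- pairs outside the cycle: leaf pairs and stub pairs
  have hLnotC : ∀ i, i < m → s(att i, ℓ i) ∉ edgeSet n v := fun i hi =>
    Box.leaf_pair_not_mem (E := edgeSet n v) (fun k hk f hf hℓ => hleaf k hk f hf hℓ) hne hi ∘ id
  have hWnotC : ∀ {j : ℕ}, j ≤ b → ∀ i, i < j → s(w i, w (i + 1)) ∉ edgeSet n v := by
    intro j hj i hi hmem
    have hd := hwfreshC (i + 1) (Nat.succ_pos i) (by omega) _ hmem (Sym2.mem_mk_right _ _)
    rw [Sym2.mk_isDiag_iff] at hd
    exact absurd (hwinj i (i + 1) (by omega) (by omega) hd) (by omega)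
  -- no loops in `E₀`
  have hnd : ∀ f ∈ E₀, ¬ f.IsDiag := by
    rintro f (⟨i, hi, rfl⟩ | ⟨i, hi, rfl⟩)
    · rw [edge, Sym2.mk_isDiag_iff]; exact v_ne_succ hn hinj hper hi
    · rw [Sym2.mk_isDiag_iff]; exact hne i hi
  -- the HANDLE PRINCIPLE with `K = cycle ∪ forest`
  refine Pendant.handle_vertex_sum_nonneg_of (E₀ := E₀) hu0 hw0 hufresh hwfresh huinj hwinj hsu hsw hPw hzu ?_ ?_ hnd hx hxs hxy hxz hyz hg hF hG
  · -- (⊕): the cycle ∪ forest ∪ stub_j is ⊕-positive at `P` (THEOREM ⊕-CYCLE, extension form, no forced pairs)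
    intro j hj K₁ K₂ hK₁ hso₁ hK₂ hso₂
    have hfW : ∀ i, 0 < i → i ≤ b → ∀ f ∈ E₀, w i ∈ f → f.IsDiag := hwfresh
    have hev : ∀ T : Set (Sym2 V), v p ∈ openCluster (T ∩ (E₀ ∪ edgeSet j w)) (v 0) ↔ v p ∈ openCluster (T ∩ edgeSet n v) (v 0) := by
      intro T
      rw [Box.mem_path_iff hfW hwinj hsw hj.le T hPw]
      exact Box.mem_leaves_iff hleaf hne hsℓ le_rfl T hPℓ
    have hdomx : ∀ T T' : Set (Sym2 V), (∀ e ∉ edgeSet n v, (e ∈ T' ↔ e ∉ T)) →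
        openCluster (T'ᶜ ∩ edgeSet n v) (v 0) ⊆ openCluster (T ∩ edgeSet n v) (v 0) →
        openCluster (T'ᶜ ∩ (E₀ ∪ edgeSet j w)) (v 0) ⊆ openCluster (T ∩ (E₀ ∪ edgeSet j w)) (v 0) := by
      intro T T' hflip hdom
      refine Box.dom_path hfW hwinj hsw hj.le (fun i hi => hflip _ (hWnotC hj.le i hi)) ?_
      exact Box.dom_leaves hleaf hne hsℓ le_rfl (fun i hi => hflip _ (hLnotC i hi)) hdom
    have h := oplus_cycle_ext hn hinj hper hp0 hpn (fun _ => False) (E₀ ∪ edgeSet j w) hev hdomx K₁ K₂ hK₁ hso₁ hK₂ hso₂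
    convert h using 2
    ext ω
    simp only [Finset.mem_filter, Finset.mem_univ, true_and]
    exact ⟨fun h => ⟨fun _ _ hf => hf.elim, h⟩, fun h => h.2⟩
  · -- (M): PR4 on the cycle ∪ forest (extension form, no forced pairs)
    intro K₁ K₂ hK₁ hso₁ hK₂ hso₂
    have hev : ∀ T : Set (Sym2 V), v p ∈ openCluster (T ∩ E₀) (v 0) ↔ v p ∈ openCluster (T ∩ edgeSet n v) (v 0) :=
      fun T => Box.mem_leaves_iff hleaf hne hsℓ le_rfl T hPℓ
    have hevY : ∀ T : Set (Sym2 V), v q ∈ openCluster (Tᶜ ∩ E₀) (v 0) ↔ v q ∈ openCluster (Tᶜ ∩ edgeSet n v) (v 0) :=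
      fun T => Box.mem_leaves_iff hleaf hne hsℓ le_rfl Tᶜ hQℓ
    have hdomx : ∀ T T' : Set (Sym2 V), (∀ e ∉ edgeSet n v, (e ∈ T' ↔ e ∉ T)) →
        openCluster (T'ᶜ ∩ edgeSet n v) (v 0) ⊆ openCluster (T ∩ edgeSet n v) (v 0) →
        openCluster (T'ᶜ ∩ E₀) (v 0) ⊆ openCluster (T ∩ E₀) (v 0) :=
      fun T T' hflip hdom => Box.dom_leaves hleaf hne hsℓ le_rfl (fun i hi => hflip _ (hLnotC i hi)) hdom
    have h := termTwo_cycle_ext hn hinj hper hp0 hpn hq0 hqn (fun _ => False) E₀ hev hevY hdomx K₁ K₂ hK₁ hso₁ hK₂ hso₂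
    convert h using 2
    ext ω
    simp only [Finset.mem_filter, Finset.mem_univ, true_and]
    exact ⟨fun h => ⟨fun _ _ hf => hf.elim, h⟩, fun h => h.2⟩

end Cyc

end Antithetic

end Summit.CriticalPhenomena.PercolationContinuityZ3.Theorems
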